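import Summits.ResolutionOfSingularities.ResolutionOfSingularities.Theorems.FrobeniusLadderFInjectiveMacaulayficationTauCentreCharts
import Summits.ResolutionOfSingularities.ResolutionOfSingularities.Theorems.FrobeniusLadderFInjectiveMacaulayficationTauFloorOneNotFull
import Summits.ResolutionOfSingularities.ResolutionOfSingularities.Theorems.FrobeniusLadderFInjectiveMacaulayficationAffineBlowupStalkClause
import Summits.ResolutionOfSingularities.ResolutionOfSingularities.Theorems.FrobeniusLadderFInjectiveMacaulayficationE8Char5FiModel
import Summits.ResolutionOfSingularities.ResolutionOfSingularities.Theorems.FrobeniusLadderFInjectiveMacaulayficationHypersurfaceRegular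
import Summits.ResolutionOfSingularities.ResolutionOfSingularities.Theorems.FrobeniusLadderFInjectiveMacaulayficationLevelTwoBlockTranslate
import Summits.ResolutionOfSingularities.ResolutionOfSingularities.Theorems.FrobeniusLadderFInjectiveMacaulayficationRegularBlowupModelDim2
import Literature.AlgebraicGeometry.Resolution.AffineBlowupUnique
import Literature.AlgebraicGeometry.Resolution.AffineBlowupUniversal
import Literature.AlgebraicGeometry.Resolution.AffineBlowupIntegral
import HarnessLib

/-!
# F4POS-1 (ii-b): THE BLOWING UP OF THE FIRST τ-FLOOR CHART RING OF P2d4C ALONG ITS NON-FULL LOCUS `(x̄, z̄′)` IS FULL AT EVERY POINT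
# (crux `FInjectiveMacaulayfication` stmt-ResolutionOfSingularities-15315, chain w45a; res-L1-w45a-plan-1 RULING R18.4 (1) (ii) «cure by the τ-centre»,
# kernel shadow of TAU-PROBE (T3) on the principal chart; seat res-L1-w45a-stub-2 g7)

[OURS · L1 W4.5a] Support file (`--supports stmt-ResolutionOfSingularities-15315 --as helper`); def-free, unconditional; replaces the role of NO printed item;
NOT a statement of the manuscript; AI-written (AI review is weaker than expert review).

SETTING (as in `TauFloorOneNotFull`, `TauCentreCharts`). `C′ = k[x,y,u,t,z′]/(f′)`, `f′ = z′² + x²z′ + x²(y³+u³+t³)`, `char k = 2`; `τ₁ := (x̄, z̄′) ⊂ C′`. By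
`TauFloorOneNotFull.not_fullCl_stalk_of_mem_VXZ` every point of `V(x̄, z̄′)` is NON-FULL. HERE, for the tree's explicit model `affineBlowup (x̄, z̄′) = Proj C′[τ₁t]`
(`Literature…AffineBlowup`, with `affineBlowup.isBlowup`):
* §1 `pderiv_four_chart`, `fullCl_atPrime_of_not_le` — off `V(τ₁)` the local rings of `C′` are regular (`∂f′/∂z′ = x²`), hence FULL;
* §2 `chartA_clause` — chart A `k[Y]/(g_A)` satisfies the CM + Frobenius-closed clause at every maximal ideal (the kernel-checked thin Fedder cell
  `P2d4CChar2Fan.hcheck 0` through `KLocCellRange.honQuot_of_kLocCells_range`, `J = ∅`); `chartB_clause` — chart B `k[Y]/(g_B)` is regular at every prime;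
* §3 ★★ `affineBlowup_tauCentre_fullCl` — **EVERY stalk of `affineBlowup (span {x̄, z̄′})` is FULL** (`AffineBlowupStalkClause.stub_affineBlowupStalkClause` on the
  chart presentations `TauCentreCharts.exists_chartEquiv` ∘ `reesChartEquiv`); ★★ `tauFloorOne_nonFull_locus_and_cure` — «the non-FULL locus of `Spec C′` is
  EXACTLY `V(x̄, z̄′)`» ∧ «the blowing up along it is FULL everywhere»: the τ-centre CURES the 3-dimensional non-FULL locus of floor 1 in ONE blow-up;
  ★★ `tauCentre_fHalfShape` — the same in the F-half's OUTPUT currency on `Spec C′`: `𝒦 := (x̄, z̄′)~ ≠ ⊥`, `supp 𝒦 = the non-FULL locus` EXACTLY, and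
  EVERY blowing up `π : S″ → Spec C′` along `𝒦` (`IsBlowup π 𝒦`) is FULL at every point (`IsBlowup.unique` + stalk transport).
HONESTY (R18.4 (iii)). NOT claimed: that `Spec C′` is a chart of `Bl_{τ(X)} X` for `X = V(z²+x⁴z+y³+u³+t³)` at scheme level (res-L1-w45a-stub-1's identification
`FCentreE1ChartPresentation` is ring level), Cohen–Macaulayness / admissibility of any global `S′`, anything about the CI charts `D(y), D(u), D(t)` of `Bl_𝔮̄ X`
(res-L1-w45a-stub-1 F4POS-1 (c)), anything of [claim: Hironaka2017]. The census sentence «floor 2 of the τ-tower of P2d4C is FULL on the principal chart» (TAU-PROBE (T3))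
is OURS, counted 0.
[folklore glue; cite: Fedder1983, Prop. 1.7 and Thm. 1.12; StacksProject, Tag 0804; Hartshorne1977, I Thm. 5.1]
-/

-- single-problem summit: the doubled namespace component is forced
set_option linter.dupNamespace false

noncomputable section

open AlgebraicGeometry CategoryTheory Literature.AlgebraicGeometry.Resolution TopologicalSpace IsLocalRing MvPolynomial

namespace Summit.ResolutionOfSingularities.ResolutionOfSingularities.Theorems.FInjectiveMacaulayfication.TauCentreBlowupFull

open Summit.ResolutionOfSingularities.ResolutionOfSingularities.Theorems.FInjectiveMacaulayfication
open SliceableCentre FCentreE1ChartWitness FCentreE1ChartPresentation TauFloorOneNotFull TauCentreCharts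

/-! ## §1 `∂f′/∂z′ = x²`; off `V(x̄, z̄′)` the local rings of `C′` are regular, hence FULL -/

/-- `∂f′/∂z′ = x²` (characteristic 2). [folklore] -/
theorem pderiv_four_chart (k : Type) [Field k] [CharP k 2] (F' : MvPolynomial (Fin 5) k)
    (hF : F' = X 4 ^ 2 + X 0 ^ 2 * X 4 + X 0 ^ 2 * (X 1 ^ 3 + X 2 ^ 3 + X 3 ^ 3)) : pderiv 4 F' = X 0 ^ 2 := by
  have h2 : (2 : MvPolynomial (Fin 5) k) = 0 := (FermatCubicConeChar2.two_three k (n := 5)).1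
  rw [hF]
  simp only [map_add, Derivation.leibniz, pderiv_pow, pderiv_X_self, pderiv_X_of_ne (show (0 : Fin 5) ≠ 4 by decide),
    pderiv_X_of_ne (show (1 : Fin 5) ≠ 4 by decide), pderiv_X_of_ne (show (2 : Fin 5) ≠ 4 by decide),
    pderiv_X_of_ne (show (3 : Fin 5) ≠ 4 by decide), smul_eq_mul, mul_zero, mul_one, add_zero]
  push_cast
  rw [h2]
  ring

/-- **At a prime `P ⊉ (x̄, z̄′)` the local ring `C′_P` is FULL**: `x̄ ∉ P` (if `x̄ ∈ P` then `z̄′² = x̄²·(…) ∈ P`, so `(x̄, z̄′) ⊆ P`), hence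
`∂f′/∂z′ = x² ∉ P` and `C′_P` is regular (Jacobian), hence FULL (`FTemkinClosedPoints.fullCl_of_isRegularLocalRing`). [cite: Hartshorne1977, I Thm. 5.1] -/
theorem fullCl_atPrime_of_not_le (k : Type) [Field k] [CharP k 2] (F' : MvPolynomial (Fin 5) k)
    (hF : F' = X 4 ^ 2 + X 0 ^ 2 * X 4 + X 0 ^ 2 * (X 1 ^ 3 + X 2 ^ 3 + X 3 ^ 3))
    (P : Ideal (MvPolynomial (Fin 5) k ⧸ Ideal.span {F'})) [P.IsPrime]
    (hP : ¬ Ideal.span ({Ideal.Quotient.mk (Ideal.span {F'}) (X 0), Ideal.Quotient.mk (Ideal.span {F'}) (X 4)} :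
      Set (MvPolynomial (Fin 5) k ⧸ Ideal.span {F'})) ≤ P) :
    FullCl 2 (Localization.AtPrime P) := by
  haveI : Fact (Nat.Prime 2) := ⟨Nat.prime_two⟩
  have hx : Ideal.Quotient.mk (Ideal.span {F'}) (X 0) ∉ P := by
    intro hx
    apply hP
    rw [Ideal.span_le]
    rintro r hr
    rcases hr with rfl | rfl
    · exact hx
    · apply ‹P.IsPrime›.mem_of_pow_mem 2
      rw [sq_z_eq k F' hF]
      exact Ideal.mul_mem_right _ _ (Ideal.pow_mem_of_mem _ hx 2 (by norm_num))
  haveI : IsRegularLocalRing (Localization.AtPrime P) :=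
    HypersurfaceRegular.stub_hypersurfaceRegularOfPderiv k 5 F' 4 P (by
      rw [pderiv_four_chart k F' hF, Ideal.mem_comap, map_pow]
      exact fun h => hx (‹P.IsPrime›.mem_of_pow_mem 2 h))
  haveI : CharP (MvPolynomial (Fin 5) k ⧸ Ideal.span {F'}) 2 := by
    haveI := isPrime_span_chart k F' hF
    haveI : IsDomain (MvPolynomial (Fin 5) k ⧸ Ideal.span {F'}) := Ideal.Quotient.isDomain _
    exact charP_of_injective_algebraMap (algebraMap k (MvPolynomial (Fin 5) k ⧸ Ideal.span {F'})).injective 2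
  haveI : CharP (Localization.AtPrime P) 2 := DegreeZeroDescent.charP_localization_atPrime 2 P
  exact FTemkinClosedPoints.fullCl_of_isRegularLocalRing 2 (Localization.AtPrime P)

/-! ## §2 The clause on the two chart rings -/

/-- **Chart A satisfies the CM + Frobenius-closed clause at every maximal ideal** — the kernel-checked thin Fedder cell of chart 0 of the P2d4C fan
(`P2d4CChar2Fan.hcheck 0`: the `2`-basis class of `x z₁` in `g_A` is the constant `1`) through `KLocCellRange.honQuot_of_kLocCells_range` (`J = ∅`).
[cite: Fedder1983, Prop. 1.7 and Thm. 1.12] -/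
theorem chartA_clause (k : Type) [Field k] [CharP k 2]
    (Q : Ideal (MvPolynomial (Fin 5) k ⧸ Ideal.span {KLocCellKit.evalL k (P2d4CChar2Fan.G 0)})) [Q.IsMaximal] :
    ∀ d : ℕ, ringKrullDim (Localization.AtPrime Q) = d → ∀ s : Fin d → Localization.AtPrime Q,
      (Ideal.span (Set.range s)).radical.IsMaximal →
        RingTheory.Sequence.IsWeaklyRegular (Localization.AtPrime Q) (List.ofFn s) ∧
        ∀ y : Localization.AtPrime Q, (∃ e : ℕ, y ^ 2 ^ e ∈ Ideal.span
          ((fun z : Localization.AtPrime Q => z ^ 2 ^ e) ''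
            (Ideal.span (Set.range s) : Set (Localization.AtPrime Q)))) → y ∈ Ideal.span (Set.range s) := by
  haveI : Fact (Nat.Prime 2) := ⟨Nat.prime_two⟩
  have hI : Ideal.span (Set.range (![KLocCellKit.evalL k (P2d4CChar2Fan.G 0)] : Fin 1 → MvPolynomial (Fin 5) k)) =
      Ideal.span {KLocCellKit.evalL k (P2d4CChar2Fan.G 0)} := by
    rw [LevelTwoBlockTranslate.range_vec_one]
  let e : (MvPolynomial (Fin 5) k ⧸ Ideal.span (Set.range (![KLocCellKit.evalL k (P2d4CChar2Fan.G 0)] : Fin 1 → MvPolynomial (Fin 5) k))) ≃+*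
      (MvPolynomial (Fin 5) k ⧸ Ideal.span {KLocCellKit.evalL k (P2d4CChar2Fan.G 0)}) := Ideal.quotEquivOfEq hI
  have hon := KLocCellRange.honQuot_of_kLocCells_range 2 k 5 (∅ : Finset (Fin 5)) VA
    (![KLocCellKit.evalL k (P2d4CChar2Fan.G 0)] : Fin 1 → MvPolynomial (Fin 5) k)
    (P2d4CChar2Fan.hg0 k 0) (P2d4CChar2Fan.hX k 0) ((P2d4CChar2Fan.CELLS 0).map Prod.fst)
    (fun T _ => ⟨∅, P2d4CChar2Fan.hS_raw 0, Finset.empty_subset T⟩)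
    (KLocCellKit.klocCells_of_check k 2 (P2d4CChar2Fan.G 0) (P2d4CChar2Fan.CELLS 0) (P2d4CChar2Fan.hcheck 0))
  exact E8Char5FiModel.clause_maximal_of_ringEquiv 2 e (e.symm 0) 0 (e.apply_symm_apply 0)
    (fun Q' hQ' _ => by haveI := hQ'; exact (hon Q' (fun j hj => absurd hj (Finset.notMem_empty j))).2) Q Q.zero_mem

/-- **Chart B is regular at every prime** (`∂g_B/∂z′ = x₁²`; `x₁ ∈ Q` would force `g_B ≡ 1 ∈ Q`), hence satisfies the clause at every maximal ideal.
[cite: Hartshorne1977, I Thm. 5.1] -/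
theorem chartB_clause (k : Type) [Field k] [CharP k 2]
    (Q : Ideal (MvPolynomial (Fin 5) k ⧸ Ideal.span {KLocCellKit.evalL k GB})) [Q.IsPrime] :
    ∀ d : ℕ, ringKrullDim (Localization.AtPrime Q) = d → ∀ s : Fin d → Localization.AtPrime Q,
      (Ideal.span (Set.range s)).radical.IsMaximal →
        RingTheory.Sequence.IsWeaklyRegular (Localization.AtPrime Q) (List.ofFn s) ∧
        ∀ y : Localization.AtPrime Q, (∃ e : ℕ, y ^ 2 ^ e ∈ Ideal.span
          ((fun z : Localization.AtPrime Q => z ^ 2 ^ e) ''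
            (Ideal.span (Set.range s) : Set (Localization.AtPrime Q)))) → y ∈ Ideal.span (Set.range s) := by
  haveI : Fact (Nat.Prime 2) := ⟨Nat.prime_two⟩
  have hgB : KLocCellKit.evalL k GB = 1 + X 0 ^ 2 * X 4 + X 0 ^ 2 * (X 1 ^ 3 + X 2 ^ 3 + X 3 ^ 3) := (gB_eq_evalL k).symm
  have hd : pderiv 4 (KLocCellKit.evalL k GB) = X 0 ^ 2 := by
    rw [hgB]
    simp only [map_add, Derivation.leibniz, pderiv_pow, pderiv_X_self, pderiv_X_of_ne (show (0 : Fin 5) ≠ 4 by decide),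
      pderiv_X_of_ne (show (1 : Fin 5) ≠ 4 by decide), pderiv_X_of_ne (show (2 : Fin 5) ≠ 4 by decide),
      pderiv_X_of_ne (show (3 : Fin 5) ≠ 4 by decide), smul_eq_mul, mul_zero, mul_one, add_zero]
    simp
  have hP' : (Q.comap (Ideal.Quotient.mk (Ideal.span {KLocCellKit.evalL k GB}))).IsPrime := Ideal.comap_isPrime _ _
  have hx : (X 0 : MvPolynomial (Fin 5) k) ∉ Q.comap (Ideal.Quotient.mk (Ideal.span {KLocCellKit.evalL k GB})) := by
    intro hx
    have hgQ : KLocCellKit.evalL k GB ∈ Q.comap (Ideal.Quotient.mk (Ideal.span {KLocCellKit.evalL k GB})) :=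
      FermatCubicConeChar2.self_mem_comap _ Q
    have h1 : (1 : MvPolynomial (Fin 5) k) = KLocCellKit.evalL k GB - (X 0 ^ 2 * X 4 + X 0 ^ 2 * (X 1 ^ 3 + X 2 ^ 3 + X 3 ^ 3)) := by
      rw [hgB]; ring
    apply hP'.ne_top
    rw [Ideal.eq_top_iff_one, h1]
    refine Ideal.sub_mem _ hgQ (Ideal.add_mem _ ?_ ?_)
    · exact Ideal.mul_mem_right _ _ (Ideal.pow_mem_of_mem _ hx 2 (by norm_num))
    · exact Ideal.mul_mem_right _ _ (Ideal.pow_mem_of_mem _ hx 2 (by norm_num))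
  haveI : IsRegularLocalRing (Localization.AtPrime Q) :=
    HypersurfaceRegular.stub_hypersurfaceRegularOfPderiv k 5 (KLocCellKit.evalL k GB) 4 Q (by
      rw [hd]
      exact fun h => hx (hP'.mem_of_pow_mem 2 h))
  haveI : CharP (Localization.AtPrime Q) 2 :=
    charP_of_injective_algebraMap (algebraMap k (Localization.AtPrime Q)).injective 2
  exact (FTemkinClosedPoints.fullCl_of_isRegularLocalRing 2 (Localization.AtPrime Q)).2

/-! ## §3 ★★ The blowing up along `(x̄, z̄′)` is FULL at every point -/

set_option maxHeartbeats 800000 in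
-- budget: Rees chart types (as in `GermOfGlobalBlowup.hypersurfacePointBlowup_fullCl`)
/-- ★★ **THE BLOWING UP OF `Spec C′` ALONG `τ = (x̄, z̄′)` IS FULL AT EVERY POINT** (`C′ = k[x,y,u,t,z′]/(z′²+x²z′+x²(y³+u³+t³))`, `char k = 2`; the
model is the tree's `affineBlowup (x̄, z̄′) = Proj C′[τt]`): off `V(τ)` the base is regular (§2); the Rees chart at `x̄t` is `k[Y]/(g_A)`, F-pure and
CI (thin Fedder cell of the P2d4C fan's chart 0), the Rees chart at `z̄′t` is `k[Y]/(g_B)`, regular (§3); `AffineBlowupStalkClause` glues. This is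
the kernel form of «the τ-centre CURES the positive-dimensional non-FULL locus of floor 1 in ONE blow-up» on the principal chart (res-L1-w45a-plan-1
TAU-PROBE (T3)). [OURS · certificate; cite: Fedder1983, Thm. 1.12; StacksProject, Tag 0804] -/
theorem affineBlowup_tauCentre_fullCl (k : Type) [Field k] [CharP k 2] (F' : MvPolynomial (Fin 5) k)
    (hF : F' = X 4 ^ 2 + X 0 ^ 2 * X 4 + X 0 ^ 2 * (X 1 ^ 3 + X 2 ^ 3 + X 3 ^ 3)) :
    ∀ y : ↥(affineBlowup (Ideal.span ({Ideal.Quotient.mk (Ideal.span {F'}) (X 0), Ideal.Quotient.mk (Ideal.span {F'}) (X 4)} :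
        Set (MvPolynomial (Fin 5) k ⧸ Ideal.span {F'})))),
      FullCl 2 ((affineBlowup (Ideal.span ({Ideal.Quotient.mk (Ideal.span {F'}) (X 0), Ideal.Quotient.mk (Ideal.span {F'}) (X 4)} :
        Set (MvPolynomial (Fin 5) k ⧸ Ideal.span {F'})))).presheaf.stalk y) := by
  classical
  haveI : Fact (Nat.Prime 2) := ⟨Nat.prime_two⟩
  haveI hprime := isPrime_span_chart k F' hF
  haveI : IsDomain (MvPolynomial (Fin 5) k ⧸ Ideal.span {F'}) := Ideal.Quotient.isDomain _
  haveI : CharP (MvPolynomial (Fin 5) k ⧸ Ideal.span {F'}) 2 :=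
    charP_of_injective_algebraMap (algebraMap k (MvPolynomial (Fin 5) k ⧸ Ideal.span {F'})).injective 2
  set R := MvPolynomial (Fin 5) k ⧸ Ideal.span {F'} with hR
  set mk : MvPolynomial (Fin 5) k →+* R := Ideal.Quotient.mk (Ideal.span {F'}) with hmk
  set I : Ideal R := Ideal.span {mk (X 0), mk (X 4)} with hIdef
  -- the generators, written as the chart vertices `u_A = mk x^{mvA} (= x̄)`, `u_B = mk x^{mvB} (= z̄′)`
  let x : Fin 2 → R := ![mk (monomial (Finsupp.equivFunOnFinite.symm mvA) (1 : k)), mk (monomial (Finsupp.equivFunOnFinite.symm mvB) (1 : k))]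
  have hx0 : x 0 = mk (X 0) := by
    change mk _ = _; rw [(monomial_mv k).1]
  have hx1 : x 1 = mk (X 4) := by
    change mk _ = _; rw [(monomial_mv k).2]
  have hxI : ∀ i, x i ∈ I := by
    intro i
    fin_cases i
    · exact hx0 ▸ Ideal.subset_span (Or.inl rfl)
    · exact hx1 ▸ Ideal.subset_span (Or.inr rfl)
  have hspan : Ideal.span (Set.range x) = I := by
    apply le_antisymm
    · rw [Ideal.span_le]; rintro _ ⟨i, rfl⟩; exact hxI i
    · rw [hIdef, Ideal.span_le]
      rintro r hr
      rcases hr with rfl | rfl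
      · exact hx0 ▸ Ideal.subset_span ⟨0, rfl⟩
      · exact hx1 ▸ Ideal.subset_span ⟨1, rfl⟩
  have hIne : I ≠ ⊥ := fun hbot =>
    mk_X_ne_zero_chart k F' hF 0 ((Ideal.mem_bot).mp (hbot ▸ Ideal.subset_span (Or.inl rfl) : mk (X 0) ∈ (⊥ : Ideal R)))
  intro y
  refine AffineBlowupStalkClause.stub_affineBlowupStalkClause 2 R I 2 x hxI hspan hIne ?_ ?_ y
  · -- off `V(I)`: regular, hence FULL
    intro P _ hP
    exact fullCl_atPrime_of_not_le k F' hF P hP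
  · -- the two Rees charts
    intro i hi Q hQ huQ
    obtain rfl | rfl : i = 0 ∨ i = 1 := by
      rcases i with ⟨_ | _ | n, hn⟩
      · exact Or.inl rfl
      · exact Or.inr rfl
      · omega
    · -- chart A: `u_A = x̄`, `k[Y]/(g_A)` with `g_A` = chart 0 of the P2d4C fan
      obtain ⟨eA⟩ := exists_chartEquiv k F' hF VA (Matrix.isUnit_det_of_left_inverse hVA_raw) mvA avA hgenA_raw havA_raw hgeA_raw dvA
        (KLocCellKit.evalL k (P2d4CChar2Fan.G 0)) (theta_A k F' hF) (P2d4CChar2Fan.hX k 0)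
      let E := eA.trans (reesChartEquiv (I := I) (x 0) (hxI 0)).symm
      exact E8Char5FiModel.clause_maximal_of_ringEquiv 2 E (E.symm (reesChartBase (x 0) (hxI 0) (x 0)))
        (reesChartBase (x 0) (hxI 0) (x 0)) (E.apply_symm_apply _) (fun Q' hQ' _ => by haveI := hQ'; exact chartA_clause k Q') Q
        (hQ := hQ) huQ
    · -- chart B: `u_B = z̄′`, `k[Y]/(g_B)` regular
      obtain ⟨eB⟩ := exists_chartEquiv k F' hF VB (Matrix.isUnit_det_of_left_inverse hVB_raw) mvB avB hgenB_raw havB_raw hgeB_raw dvB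
        (KLocCellKit.evalL k GB) (theta_B k F' hF) (hXB k)
      let E := eB.trans (reesChartEquiv (I := I) (x 1) (hxI 1)).symm
      exact E8Char5FiModel.clause_maximal_of_ringEquiv 2 E (E.symm (reesChartBase (x 1) (hxI 1) (x 1)))
        (reesChartBase (x 1) (hxI 1) (x 1)) (E.apply_symm_apply _) (fun Q' hQ' _ => by haveI := hQ'.isPrime; exact chartB_clause k Q') Q
        (hQ := hQ) huQ

/-- ★★ **FLOOR 1 OF THE τ-TOWER, PRINCIPAL CHART, COMPLETE PICTURE**: (a) the NON-FULL locus of `Spec C′` is EXACTLY `V(x̄, z̄′)` (⊇: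
`TauFloorOneNotFull.not_fullCl_stalk_of_mem_VXZ`; ⊆: §2 transported to stalks), a 3-dimensional closed subset; (b) the blowing up along `(x̄, z̄′)`,
whose centre is supported exactly on that locus, is FULL at every point. [OURS · certificate] -/
theorem tauFloorOne_nonFull_locus_and_cure (k : Type) [Field k] [CharP k 2] (F' : MvPolynomial (Fin 5) k)
    (hF : F' = X 4 ^ 2 + X 0 ^ 2 * X 4 + X 0 ^ 2 * (X 1 ^ 3 + X 2 ^ 3 + X 3 ^ 3)) :
    (∀ w : Spec (.of (MvPolynomial (Fin 5) k ⧸ Ideal.span {F'})),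
      ¬ FullCl 2 ((Spec (.of (MvPolynomial (Fin 5) k ⧸ Ideal.span {F'}))).presheaf.stalk w) ↔
        (Ideal.Quotient.mk (Ideal.span {F'}) (X 0) ∈ w.asIdeal ∧ Ideal.Quotient.mk (Ideal.span {F'}) (X 4) ∈ w.asIdeal)) ∧
    ∀ y : ↥(affineBlowup (Ideal.span ({Ideal.Quotient.mk (Ideal.span {F'}) (X 0), Ideal.Quotient.mk (Ideal.span {F'}) (X 4)} :
        Set (MvPolynomial (Fin 5) k ⧸ Ideal.span {F'})))),
      FullCl 2 ((affineBlowup (Ideal.span ({Ideal.Quotient.mk (Ideal.span {F'}) (X 0), Ideal.Quotient.mk (Ideal.span {F'}) (X 4)} :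
        Set (MvPolynomial (Fin 5) k ⧸ Ideal.span {F'})))).presheaf.stalk y) := by
  refine ⟨fun w => ⟨fun hw => ?_, fun h => not_fullCl_stalk_of_mem_VXZ k F' hF w h.1 h.2⟩, affineBlowup_tauCentre_fullCl k F' hF⟩
  by_contra hxz
  apply hw
  have hle : ¬ Ideal.span ({Ideal.Quotient.mk (Ideal.span {F'}) (X 0), Ideal.Quotient.mk (Ideal.span {F'}) (X 4)} :
      Set (MvPolynomial (Fin 5) k ⧸ Ideal.span {F'})) ≤ w.asIdeal := by
    intro hle
    exact hxz ⟨hle (Ideal.subset_span (Or.inl rfl)), hle (Ideal.subset_span (Or.inr rfl))⟩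
  exact WFixAtNonClosedDimTwo.fullCl_of_ringEquiv 2 (Spec.stalkIso (.of _) w).commRingCatIsoToRingEquiv.symm
    (fullCl_atPrime_of_not_le k F' hF w.asIdeal hle)

/-- ★★ **THE CURE IN THE F-HALF'S OUTPUT CURRENCY** (cf. the conclusion of `LocalFullificationFibreAdmGe4Split.LocalFInjectivizationFibreAdmGe4`:
`∃ 𝓚 ≠ ⊥, supp-condition ∧ ∀ S″ π, IsBlowup π 𝓚 → ∀ s, FullCl p 𝒪_{S″,s}`), on the principal chart `Spec C′` of floor 1: with `𝒦 := (x̄, z̄′)~`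
(`affineBlowup.idealSheaf`), (a) `𝒦 ≠ ⊥`; (b) `supp 𝒦` is EXACTLY the non-FULL locus of `Spec C′`; (c) EVERY blowing up of `Spec C′` along `𝒦` is FULL at
every point (any two blowings up along `𝒦` are isomorphic over the base, `IsBlowup.unique`; FULL moves along isomorphic stalks). What this is NOT: the
F-half itself (whose base is `Spec 𝒪_{X,x}` and whose `S′` is the full local blow-up, all charts) — only its shape on one chart of one floor of one
specimen. [OURS · certificate; cite: GortzWedhorn2020, Prop. 13.92; StacksProject, Tag 0804] -/
theorem tauCentre_fHalfShape (k : Type) [Field k] [CharP k 2] (F' : MvPolynomial (Fin 5) k)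
    (hF : F' = X 4 ^ 2 + X 0 ^ 2 * X 4 + X 0 ^ 2 * (X 1 ^ 3 + X 2 ^ 3 + X 3 ^ 3)) :
    affineBlowup.idealSheaf (Ideal.span ({Ideal.Quotient.mk (Ideal.span {F'}) (X 0), Ideal.Quotient.mk (Ideal.span {F'}) (X 4)} :
        Set (MvPolynomial (Fin 5) k ⧸ Ideal.span {F'}))) ≠ ⊥ ∧
    (∀ w : Spec (.of (MvPolynomial (Fin 5) k ⧸ Ideal.span {F'})),
      w ∈ ((affineBlowup.idealSheaf (Ideal.span ({Ideal.Quotient.mk (Ideal.span {F'}) (X 0), Ideal.Quotient.mk (Ideal.span {F'}) (X 4)} :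
        Set (MvPolynomial (Fin 5) k ⧸ Ideal.span {F'})))).support : Set (Spec (.of (MvPolynomial (Fin 5) k ⧸ Ideal.span {F'})))) ↔
        ¬ FullCl 2 ((Spec (.of (MvPolynomial (Fin 5) k ⧸ Ideal.span {F'}))).presheaf.stalk w)) ∧
    ∀ (S'' : Scheme.{0}) (π : S'' ⟶ Spec (.of (MvPolynomial (Fin 5) k ⧸ Ideal.span {F'}))),
      IsBlowup π (affineBlowup.idealSheaf (Ideal.span ({Ideal.Quotient.mk (Ideal.span {F'}) (X 0), Ideal.Quotient.mk (Ideal.span {F'}) (X 4)} :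
        Set (MvPolynomial (Fin 5) k ⧸ Ideal.span {F'})))) →
      ∀ s : S'', FullCl 2 (S''.presheaf.stalk s) := by
  haveI hprime := isPrime_span_chart k F' hF
  haveI : IsDomain (MvPolynomial (Fin 5) k ⧸ Ideal.span {F'}) := Ideal.Quotient.isDomain _
  have hIne : Ideal.span ({Ideal.Quotient.mk (Ideal.span {F'}) (X 0), Ideal.Quotient.mk (Ideal.span {F'}) (X 4)} :
      Set (MvPolynomial (Fin 5) k ⧸ Ideal.span {F'})) ≠ ⊥ := fun hbot =>
    mk_X_ne_zero_chart k F' hF 0 ((Ideal.mem_bot).mp (hbot ▸ Ideal.subset_span (Or.inl rfl)))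
  haveI := affineBlowup.isIntegral hIne
  obtain ⟨hlocus, hfull⟩ := tauFloorOne_nonFull_locus_and_cure k F' hF
  refine ⟨RegularBlowupModelDim2.ne_bot_of_isBlowup (affineBlowup.isBlowup _), fun w => ?_, fun S'' π hπ s => ?_⟩
  · rw [affineBlowup.support_idealSheaf]
    change ((Ideal.span ({Ideal.Quotient.mk (Ideal.span {F'}) (X 0), Ideal.Quotient.mk (Ideal.span {F'}) (X 4)} :
        Set (MvPolynomial (Fin 5) k ⧸ Ideal.span {F'})) : Ideal (MvPolynomial (Fin 5) k ⧸ Ideal.span {F'})) :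
        Set (MvPolynomial (Fin 5) k ⧸ Ideal.span {F'})) ⊆ w.asIdeal ↔ _
    rw [hlocus w]
    constructor
    · intro h
      exact ⟨h (Ideal.subset_span (Or.inl rfl)), h (Ideal.subset_span (Or.inr rfl))⟩
    · rintro ⟨hx, hz⟩
      refine fun r hr => ?_
      have : Ideal.span ({Ideal.Quotient.mk (Ideal.span {F'}) (X 0), Ideal.Quotient.mk (Ideal.span {F'}) (X 4)} :
          Set (MvPolynomial (Fin 5) k ⧸ Ideal.span {F'})) ≤ w.asIdeal := by
        rw [Ideal.span_le]
        rintro r' hr'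
        rcases hr' with rfl | rfl
        · exact hx
        · exact hz
      exact this hr
  · obtain ⟨e, -, -⟩ := (affineBlowup.isBlowup _).unique hπ
    exact FTemkinClosedPoints.fullCl_of_isIso_stalkMap' 2 e.inv s (hfull (e.inv.base s))

end Summit.ResolutionOfSingularities.ResolutionOfSingularities.Theorems.FInjectiveMacaulayfication.TauCentreBlowupFull

end
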